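import Summits.MatrixMultiplication.MatrixMultiplication.Theorems.AbelianSTPPCensusTAStatQNode
import Summits.MatrixMultiplication.MatrixMultiplication.Theorems.AbelianSTPPCensusTAStatLemmas

/-!
# Static t*-certificate under a general Grynkiewicz budget constant: soundness of the one-member cover, packaged once

Cell mm-stpp (rung F-M1), seat mm-stpp-vp-p2 (gen 8); census-silent kernel enabler (plan g20, HOME/STATUS 2026-08-28T22:53:43Z).  In every landed range of the
static certificate (`…TAStat{,B,C,D,E,F}Sound.lean`, `…TD2StatSound.lean`, …) the ONE-MEMBER branch of the main estimate — the maximal member `l` passes `TAStat.cover` at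
the bucket parameter, i.e. either the verified U11-type threshold lies at or below the order `M` (then the density `g/(t·p − V)` of the companions and the Grynkiewicz budget
close the estimate) or a vM piece through one of the three caps U11 / U14 / E3 holds around `M` — is re-proved inline (≈ 130 lines per range).  This file proves it ONCE for
the re-issued cover `coverQ` (budget constant `bud`, guard `t0`; `AbelianSTPPCensusTAStatQNode.lean`) from abstract ROW FACTS in the format of `HypsQ` / `TAStat2M.two_member_assembly`:
domination of every companion by the entry `e` (vM fraction; U11-type fraction at `t` with genuine weight), the companions' caps (`2Σp + d ≤ 3M`, `Σp + 3V ≤ 3M`,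
`M < 2V → Σp ≤ (⌊V²/M⌋ + 3M) − 4V`) and the budget at `t` (`t0 ≤ t → V < t·p → t·(Σ_{q≠l} p_q + p) ≤ (Σ_{q≠l} V_q + V) + t·M + bud t`): `coverQ_sound`.
Tools by name: `TAStat.pcs_sound`, `p1_between`, `p2_between`, `quad_between`, `capE_mul_le` (theory g11), `vpQ_mono`, `vpThreshQ_le`, `coverQ_cases` (this lane).
WHAT THIS IS NOT: no statement about STPP families, orders or `ω` — the arithmetic meaning of a Bool check over shape data; no data, no range, no number.
-/

set_option linter.dupNamespace false
set_option autoImplicit false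

namespace Summit.MatrixMultiplication.MatrixMultiplication.Theorems.TAStatQ

open TAStat (Entry piece pcs p1I p2I p3I pcs_sound p1_between p2_between quad_between capE_mul_le)
open ShapeCert (D)

/-- **Soundness of the one-member cover.**  Maximal member `l` (gain `g`, pair-product sum `p`, volume `V ≤ M`, excess `d`) passing `coverQ bud t0 g p V d t L H e` with
`1 ≤ L ≤ M ≤ H`; every companion `q ≠ l` dominated by `e` — `g_q·pP ≤ gP·p_q` and, with a genuine weight `V_q < t·p_q`, `g_q·wW ≤ gW·(t·p_q − V_q)` —, denominators positive;
the companions' caps U11 `2·Σ_{q≠l} p_q + d ≤ 3M`, U14 `Σ_{q≠l} p_q + 3V ≤ 3M`, E3 `M < 2V → Σ_{q≠l} p_q ≤ (⌊V²/M⌋ + 3M) − 4V`; and the budget at `t`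
(`t0 ≤ t → V < t·p → t·(Σ_{q≠l} p_q + p) ≤ (Σ_{q≠l} V_q + V) + t·M + bud t`).  Then `g + Σ_{q≠l} g_q ≤ 10⁶·M`. [original] -/
theorem coverQ_sound {bud : ℕ → ℕ} {t0 : ℕ} {N : ℕ} (l : Fin N) (gq pq Vq : Fin N → ℕ) {g p V d t L H M : ℕ} {e : Entry}
    (hc : coverQ bud t0 g p V d t L H e = true) (hL1 : 1 ≤ L) (hLM : L ≤ M) (hMH : M ≤ H) (hVM : V ≤ M)
    (hpP : 1 ≤ e.2.1) (hwW : 1 ≤ e.2.2.2)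
    (hdomP : ∀ q, q ≠ l → gq q * e.2.1 ≤ e.1 * pq q)
    (hdomW : ∀ q, q ≠ l → Vq q < t * pq q ∧ gq q * e.2.2.2 ≤ e.2.2.1 * (t * pq q - Vq q))
    (hsum1 : 2 * (∑ q ∈ Finset.univ.erase l, pq q) + d ≤ 3 * M)
    (hsum2 : (∑ q ∈ Finset.univ.erase l, pq q) + 3 * V ≤ 3 * M)
    (hcap : M < 2 * V → ∑ q ∈ Finset.univ.erase l, pq q ≤ (V * V / M + 3 * M) - 4 * V)
    (hbud : t0 ≤ t → V < t * p →
      t * ((∑ q ∈ Finset.univ.erase l, pq q) + p) ≤ ((∑ q ∈ Finset.univ.erase l, Vq q) + V) + t * M + bud t) :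
    g + ∑ q ∈ Finset.univ.erase l, gq q ≤ D * M := by
  classical
  have hmem : ∀ q ∈ Finset.univ.erase l, q ≠ l := fun q hq => (Finset.mem_erase.mp hq).1
  have hsumg : (∑ q ∈ Finset.univ.erase l, gq q) * e.2.1 ≤ e.1 * ∑ q ∈ Finset.univ.erase l, pq q := by
    rw [Finset.sum_mul, Finset.mul_sum]
    exact Finset.sum_le_sum fun q hq => hdomP q (hmem q hq)
  set M1 := vpThreshQ bud t0 g p V t L H e with hM1
  rcases coverQ_cases hc hLM with hVP | ⟨hVP, hpc⟩
  · ---------------------------------------------------------------- case U11-type bound (threshold at or below M)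
    have hM1H : M1 ≤ H := hVP.trans hMH
    obtain ⟨ht0, hVtp, hslope, hvp1, hwl1⟩ := vpThreshQ_le hM1H
    have hvp : vpIQ bud g p V t M e = true := vpQ_mono hslope hVP hvp1
    simp only [vpIQ, Nat.ble_eq] at hvp
    have hb := hbud ht0 hVtp
    -- the companions' weights are genuine, so their total weight W satisfies W + Σ V_q = t · Σ p_q
    have eW : (∑ q ∈ Finset.univ.erase l, (t * pq q - Vq q)) + ∑ q ∈ Finset.univ.erase l, Vq q =
        t * ∑ q ∈ Finset.univ.erase l, pq q := by
      rw [Finset.mul_sum, ← Finset.sum_add_distrib]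
      exact Finset.sum_congr rfl fun q hq => Nat.sub_add_cancel (hdomW q (hmem q hq)).1.le
    have hcore : (∑ q ∈ Finset.univ.erase l, (t * pq q - Vq q)) + (t * p - V) ≤ t * M + bud t := by
      generalize hA : ∑ q ∈ Finset.univ.erase l, (t * pq q - Vq q) = A at eW ⊢
      generalize hP1 : ∑ q ∈ Finset.univ.erase l, pq q = P1 at eW hb
      generalize hV1 : ∑ q ∈ Finset.univ.erase l, Vq q = V1 at eW hb
      have e1 : t * (P1 + p) = t * P1 + t * p := by ring
      rw [e1] at hb
      omega
    have hsumw : e.2.2.1 * (∑ q ∈ Finset.univ.erase l, (t * pq q - Vq q)) + e.2.2.1 * (t * p - V) ≤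
        e.2.2.1 * (t * M) + e.2.2.1 * bud t := by
      rw [← Nat.mul_add, ← Nat.mul_add]; exact Nat.mul_le_mul_left _ hcore
    have hsumgW : (∑ q ∈ Finset.univ.erase l, gq q) * e.2.2.2 ≤ e.2.2.1 * ∑ q ∈ Finset.univ.erase l, (t * pq q - Vq q) := by
      rw [Finset.sum_mul, Finset.mul_sum]
      exact Finset.sum_le_sum fun q hq => (hdomW q (hmem q hq)).2
    have key : (g + ∑ q ∈ Finset.univ.erase l, gq q) * e.2.2.2 ≤ D * M * e.2.2.2 := by
      rw [Nat.add_mul]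
      have e1 : t * e.2.2.1 * M = e.2.2.1 * (t * M) := by ring
      have e2 : bud t * e.2.2.1 = e.2.2.1 * bud t := by ring
      have e3 : (t * p - V) * e.2.2.1 = e.2.2.1 * (t * p - V) := by ring
      have e4 : D * e.2.2.2 * M = D * M * e.2.2.2 := by ring
      rw [e1, e2, e3, e4] at hvp
      generalize e.2.2.1 * (∑ q ∈ Finset.univ.erase l, (t * pq q - Vq q)) = GW at hsumgW hsumw
      generalize e.2.2.1 * (t * p - V) = GX at hsumw hvp
      generalize e.2.2.1 * bud t = GB at hsumw hvp
      generalize e.2.2.1 * (t * M) = GTM at hsumw hvp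
      generalize (∑ q ∈ Finset.univ.erase l, gq q) * e.2.2.2 = Sw at hsumgW ⊢
      generalize g * e.2.2.2 = gw at hvp ⊢
      generalize D * M * e.2.2.2 = DMw at hvp ⊢
      omega
    exact Nat.le_of_mul_le_mul_right key hwW
  · ---------------------------------------------------------------- case vM (order below the threshold)
    have hMhi : M ≤ min H (M1 - 1) := by omega
    obtain ⟨m₁, m₂, hm0, hm1, hm2, hpiece⟩ : ∃ m₁ m₂, L ≤ m₁ ∧ m₁ ≤ M ∧ M ≤ m₂ ∧ piece g V d e m₁ m₂ = true := by
      rcases hpc with hp | hp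
      · exact ⟨_, _, le_rfl, hLM, hMhi, hp⟩
      · exact pcs_sound g V d e TAStat.J _ _ hp M hLM hMhi
    have hm1' : 1 ≤ m₁ := hL1.trans hm0
    simp only [piece, Bool.or_eq_true, Bool.and_eq_true, Nat.blt_eq] at hpiece
    rcases hpiece with (⟨hP1a, hP1b⟩ | ⟨hP2a, hP2b⟩) | ⟨⟨h2V, hP3a⟩, hP3b⟩
    · -- U11 cap
      have hP := p1_between hm1 hm2 hP1a hP1b
      simp only [p1I, Nat.ble_eq] at hP
      have key : (g + ∑ q ∈ Finset.univ.erase l, gq q) * (2 * e.2.1) ≤ D * M * (2 * e.2.1) := by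
        have hs1 := Nat.mul_le_mul_left e.1 hsum1
        rw [Nat.add_mul]
        generalize (∑ q ∈ Finset.univ.erase l, gq q) = S at hsumg ⊢
        generalize (∑ q ∈ Finset.univ.erase l, pq q) = So at hsumg hs1
        generalize d = dd at hs1 hP
        generalize e.1 = gP at hsumg hs1 hP
        generalize e.2.1 = pP at hsumg hP ⊢
        have e1 : gP * (2 * So + dd) = 2 * (gP * So) + gP * dd := by ring
        rw [e1] at hs1
        generalize g = gg at hP ⊢
        generalize D = DD at hP ⊢
        ring_nf at hsumg hs1 hP ⊢
        omega
      exact Nat.le_of_mul_le_mul_right key (by omega)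
    · -- U14 cap
      have hP := p2_between hm1 hm2 hP2a hP2b
      simp only [p2I, Nat.ble_eq] at hP
      have key : (g + ∑ q ∈ Finset.univ.erase l, gq q) * e.2.1 ≤ D * M * e.2.1 := by
        have hs2 := Nat.mul_le_mul_left e.1 hsum2
        rw [Nat.add_mul]
        generalize (∑ q ∈ Finset.univ.erase l, gq q) = S at hsumg ⊢
        generalize (∑ q ∈ Finset.univ.erase l, pq q) = So at hsumg hs2
        generalize e.1 = gP at hsumg hs2 hP
        generalize e.2.1 = pP at hsumg hP ⊢
        have e1 : gP * (So + 3 * V) = gP * So + 3 * V * gP := by ring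
        rw [e1] at hs2
        generalize g = gg at hP ⊢
        generalize D = DD at hP ⊢
        ring_nf at hsumg hs2 hP ⊢
        omega
      exact Nat.le_of_mul_le_mul_right key hpP
    · -- E3 cap (M < 2V)
      have h2V' : M < 2 * V := by omega
      have hcap' := hcap h2V'
      have hM1' : 1 ≤ M := by omega
      have hP := quad_between hm1' hm1 hm2 hP3a hP3b
      simp only [p3I, Nat.ble_eq] at hP
      have hce := capE_mul_le (V := V) (M := M) hVM
      have key : (g + ∑ q ∈ Finset.univ.erase l, gq q) * e.2.1 * M ≤ D * M * e.2.1 * M := by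
        have h1' : (∑ q ∈ Finset.univ.erase l, gq q) * e.2.1 * M ≤ e.1 * (((V * V / M + 3 * M) - 4 * V) * M) := by
          calc (∑ q ∈ Finset.univ.erase l, gq q) * e.2.1 * M
              ≤ e.1 * (∑ q ∈ Finset.univ.erase l, pq q) * M := Nat.mul_le_mul_right _ hsumg
            _ ≤ e.1 * ((V * V / M + 3 * M) - 4 * V) * M := Nat.mul_le_mul_right _ (Nat.mul_le_mul_left _ hcap')
            _ = e.1 * (((V * V / M + 3 * M) - 4 * V) * M) := by ring
        have hce' := Nat.mul_le_mul_left e.1 hce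
        rw [Nat.add_mul, Nat.add_mul]
        generalize (∑ q ∈ Finset.univ.erase l, gq q) = S at h1' ⊢
        generalize ((V * V / M + 3 * M) - 4 * V) = cE at h1' hce'
        generalize e.1 = gP at h1' hce' hP
        generalize e.2.1 = pP at h1' hP ⊢
        have e1 : gP * (cE * M + 4 * V * M) = gP * (cE * M) + 4 * V * M * gP := by ring
        rw [e1] at hce'
        have e2 : gP * (V * V + 3 * M * M) = V * V * gP + 3 * M * M * gP := by ring
        rw [e2] at hce'
        generalize g = gg at hP ⊢
        generalize D = DD at hP ⊢
        ring_nf at h1' hce' hP ⊢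
        omega
      have hpos : 0 < e.2.1 * M := Nat.mul_pos hpP hM1'
      have key' : (g + ∑ q ∈ Finset.univ.erase l, gq q) * (e.2.1 * M) ≤ D * M * (e.2.1 * M) := by
        rw [← Nat.mul_assoc, ← Nat.mul_assoc]; exact key
      exact Nat.le_of_mul_le_mul_right key' hpos

end Summit.MatrixMultiplication.MatrixMultiplication.Theorems.TAStatQ
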